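import Summits.HodgeConjecture.HodgeConjecture.Theorems.K2E3UnitaryLayerCharacters               -- ★ p855984 (this seat): (Char-U) Cayley-test induction `map_trace_mul_eq_one_of_bilevel`
import Summits.HodgeConjecture.HodgeConjecture.Theorems.K2E3CongruenceLayerOccurrenceNilpotentGL -- ★ p855641 (this seat): (N) GL `exists_nilpotent_add_valBound_of_occurrence` (Cartan decomposition)
import HarnessLib

/-!
# Crux `H413` — K2-LIT E3 «EllipticInputs», U12-h engine (N-U): OCCURRENCE ⇒ NILPOTENT + BOUNDED FOR A UNITARY GROUP — if the layer character `χ_X` of a parameter `X ∈ 𝔰_ε` is trivial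
# on the unitary bi-level set `{k ∈ U(σ,J) ∩ K_{N′} : x⁻¹kx ∈ K_{ν′}}` (`x ∈ U`), then `X = Z + B` with `Z` NILPOTENT and `v(B) ≤ |ϖ|^{−(N′+d)}` — the brick `hocc` (defect `E := d`) of
# ★ p855958 `K2E3LevelTraceStableAtPlaceU.exists_levelTraceStable_U`, WITHOUT any Cartan∕Witt decomposition of `U`: the (Char-U) Cayley-test induction transfers the hypothesis to
# the GL bi-level set `{k ∈ K_{N′+d} : x⁻¹kx ∈ K_{ν′+d}}`, where ★ GL (N) applies

Cell `hodgecm-mathlib`, Track B «K2-LIT», crux item `stmt-HodgeConjecture-24833` (h413), line `K2_E3_EllipticInputs`, unit U12 «HC characters», socket U12-h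
`sig_K2E3CharLocConstNearRegular` (‹#9L›), depth-halving road, non-split transport (memo v4 (N-U); docking target K2E3-p09 (g2) ★ p855958 `hocc` with floor `m₀ := d + 1`,
`E := d`); seat K2E1b-p08 (g2); `--supports stmt-HodgeConjecture-24833 --as helper`.  THEOREMS ONLY — no `def`, no named fact, no instance, no notation, no `sorry`.  GENERIC: as ★
(Char-U) plus `[IsDiscreteValuationRing 𝒪[E]]` (★ GL (N)).  HONEST LABEL: HC_CM is proved only modulo the 7 printed citations (2 remaining named inputs: hLiu418 =
stmt-HodgeConjecture-24832, h413 = stmt-HodgeConjecture-24833) until rung 0 closes; count-neutral.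

THE MATHEMATICS [HarishChandra1999, §20 p. 84 (1) «`𝒪_0^G ⊂ 𝒩 + L^*`»; PlatonovRapinchuk1994, §3.3].  By ★ (Char-U) `map_trace_mul_eq_one_of_bilevel` (with `m := N′`, `m₂ := ν′`,
floor `d + 1 ≤ ν′ ≤ N′`), triviality of `χ_X` on the UNITARY bi-level set gives `ψ(tr(XW)) = 1` for every `W` of GL bi-level `(N′+d, ν′+d)`, in particular `χ_X ≡ 1` on the GL
bi-level set `{k ∈ K_{N′+d} : x⁻¹kx ∈ K_{ν′+d}}` (★ `coe_conj_sub_one`: `x⁻¹kx − 1 = x⁻¹(k−1)x`); ★ GL (N) at levels `(N′+d, ν′+d)` gives `X = Z + B`, `Z` nilpotent,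
`v(B) ≤ |ϖ|^{−(N′+d)}` (`exists_nilpotent_add_valBound_of_unitary_occurrence`).  The point: no structure theory of `U` (Witt basis, Cartan decomposition `U = K_U A⁺ K_U`) is needed —
the nilpotent part is found in `GL_N(E)` and `X ∈ 𝔰_ε` is remembered separately by the endgame (`S`-membership travels with `X`, not with `Z`, `B`).

## References
* [HarishChandra1999] Harish-Chandra (DeBacker–Sally), *Admissible Invariant Distributions on Reductive p-adic Groups*, ULECT 16 (1999), §17 Thm. 17.1, §20 p. 84.
* [PlatonovRapinchuk1994] V. Platonov, A. Rapinchuk, *Algebraic Groups and Number Theory* (1994), §2.3, §3.3.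
-/

set_option autoImplicit false
-- the mandated namespace repeats `HodgeConjecture.HodgeConjecture`, as in every `Theorems/*.lean` of this sub-problem
set_option linter.dupNamespace false

noncomputable section

open scoped MatrixGroups Matrix
open ValuativeRel Literature.NumberTheory.Automorphic Literature.LinearAlgebra.Matrix

namespace Summit.HodgeConjecture.HodgeConjecture.Cruxes.H413.K2E3UnitaryLayerOccurrenceNilpotent

variable {E : Type*} [Field E] [ValuativeRel E] {N : ℕ} (σ : E →+* E) {J : Matrix (Fin N) (Fin N) E} {ϖ : E} [Invertible (2 : E)]
  {M : Type*} [CommMonoid M] (ψ : AddChar E M)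

/-- **TRANSFER TO THE GL BI-LEVEL SET**: `X ∈ 𝔰_ε` of height `L₀`, `x ∈ U(σ,J)`, `χ_X ≡ 1` on `{k ∈ U ∩ K_{N′} : x⁻¹kx ∈ K_{ν′}}` with `d + 1 ≤ ν′ ≤ N′` ⇒ `χ_X ≡ 1` on the GL bi-level set
`{k ∈ K_{N′+d} : x⁻¹kx ∈ K_{ν′+d}}` (★ (Char-U) `map_trace_mul_eq_one_of_bilevel`). [cite: HarishChandra1999, §17 Thm. 17.1] [cite: PlatonovRapinchuk1994, §3.3] -/
theorem forall_map_trace_eq_one_of_unitary_occurrence (hϖ : IsUniformizingElement ϖ) (hψ : ∀ x : E, valuation E x ≤ 1 → ψ x = 1) {ε : E}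
    (hanti : ∀ a : E, σ a = ε * a → ψ a = 1) (hσ : ∀ a : E, σ (σ a) = a) (hσv : ∀ a : E, valuation E (σ a) = valuation E a) (hJ : (J.map σ)ᵀ = J)
    (hJu : IsUnit J.det) {κ κ' : ValueGroupWithZero E} (hJb : ValBound κ J) (hJib : ValBound κ' J⁻¹) {d : ℕ}
    (hd : valuation E (⅟(2 : E)) * (valuation E (⅟(2 : E)) * max 1 (κ' * κ)) * valuation E ϖ ^ d ≤ 1)
    {X : Matrix (Fin N) (Fin N) E} (hXu : J⁻¹ * (X.map σ)ᵀ * J = ε • X) {L₀ : ℕ} (hXb : ValBound (valuation E ϖ ^ L₀)⁻¹ X)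
    {x : GL (Fin N) E} (hx : x ∈ unitaryGroupOfForm σ J) {N' ν' : ℕ} (hν' : d + 1 ≤ ν') (hνN : ν' ≤ N')
    (hocc : ∀ k ∈ unitaryGroupOfForm σ J, k ∈ congruenceGL N (valuation E ϖ ^ N') → x⁻¹ * k * x ∈ congruenceGL N (valuation E ϖ ^ ν') →
      ψ (Matrix.trace (X * ((k : Matrix (Fin N) (Fin N) E) - 1))) = 1) :
    ∀ k ∈ congruenceGL N (valuation E ϖ ^ (N' + d)), x⁻¹ * k * x ∈ congruenceGL N (valuation E ϖ ^ (ν' + d)) →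
      ψ (Matrix.trace (X * ((k : Matrix (Fin N) (Fin N) E) - 1))) = 1 := by
  intro k hk hkx
  refine K2E3UnitaryLayerCharacters.map_trace_mul_eq_one_of_bilevel σ ψ hϖ hψ hanti hσ hσv hJ hJu hJb hJib hd hXu hXb hx hocc
    (by rw [max_eq_left (by omega)]) (by rw [max_eq_left (by omega)]) hk.2.1 ?_
  have h := K2E3CongruenceLayersGL.coe_conj_sub_one x⁻¹ k
  rw [inv_inv] at h
  rw [← h]
  exact hkx.2.1

/-- **OCCURRENCE ⇒ NILPOTENT + BOUNDED ON A UNITARY GROUP (brick hocc-U, defect `E := d`)**: `X ∈ 𝔰_ε` of height `L₀`, `x ∈ U(σ,J)`, `d + 1 ≤ ν′ ≤ N′`, and `χ_X ≡ 1` on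
`{k ∈ U ∩ K_{N′} : x⁻¹kx ∈ K_{ν′}}` ⇒ **`X = Z + B` with `Z` nilpotent and `v(B) ≤ |ϖ|^{−(N′+d)}`** (★ GL (N) at levels `(N′+d, ν′+d)` after the transfer). [cite: HarishChandra1999, §20 p. 84]
[cite: PlatonovRapinchuk1994, §3.3] -/
theorem exists_nilpotent_add_valBound_of_unitary_occurrence [IsDiscreteValuationRing 𝒪[E]] (hϖ : IsUniformizingElement ϖ)
    (hψ : ∀ x : E, valuation E x ≤ 1 → ψ x = 1) (hψ' : ∃ z : E, valuation E z ≤ (valuation E ϖ)⁻¹ ∧ ψ z ≠ 1) {ε : E}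
    (hanti : ∀ a : E, σ a = ε * a → ψ a = 1) (hσ : ∀ a : E, σ (σ a) = a) (hσv : ∀ a : E, valuation E (σ a) = valuation E a) (hJ : (J.map σ)ᵀ = J)
    (hJu : IsUnit J.det) {κ κ' : ValueGroupWithZero E} (hJb : ValBound κ J) (hJib : ValBound κ' J⁻¹) {d : ℕ}
    (hd : valuation E (⅟(2 : E)) * (valuation E (⅟(2 : E)) * max 1 (κ' * κ)) * valuation E ϖ ^ d ≤ 1)
    {X : Matrix (Fin N) (Fin N) E} (hXu : J⁻¹ * (X.map σ)ᵀ * J = ε • X) {L₀ : ℕ} (hXb : ValBound (valuation E ϖ ^ L₀)⁻¹ X)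
    {x : GL (Fin N) E} (hx : x ∈ unitaryGroupOfForm σ J) {N' ν' : ℕ} (hν' : d + 1 ≤ ν') (hνN : ν' ≤ N')
    (hocc : ∀ k ∈ unitaryGroupOfForm σ J, k ∈ congruenceGL N (valuation E ϖ ^ N') → x⁻¹ * k * x ∈ congruenceGL N (valuation E ϖ ^ ν') →
      ψ (Matrix.trace (X * ((k : Matrix (Fin N) (Fin N) E) - 1))) = 1) :
    ∃ Z B : Matrix (Fin N) (Fin N) E, IsNilpotent Z ∧ ValBound (valuation E ϖ ^ (N' + d))⁻¹ B ∧ X = Z + B :=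
  K2E3CongruenceLayerOccurrenceNilpotentGL.exists_nilpotent_add_valBound_of_occurrence ψ hϖ hψ' (by omega) (by omega) x
    (forall_map_trace_eq_one_of_unitary_occurrence σ ψ hϖ hψ hanti hσ hσv hJ hJu hJb hJib hd hXu hXb hx hν' hνN hocc)

end Summit.HodgeConjecture.HodgeConjecture.Cruxes.H413.K2E3UnitaryLayerOccurrenceNilpotent

end
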